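import Mathlib
import Summits.Ventures.Crystal3D.Theorems.StickyWulffConstantTextureLiminfTentBarlowFrames
import HarnessLib

/-!
# The tent certificate — broken bonds of one bilayer, pulled back to the cubic frame (eng g9)

Route `StickyWulffConstant` (`Summits/Ventures/Crystal3D`, cell `crystal3d-full`), support toward the crux
`TextureLiminf` (stmt-Ventures-19483), line TexShadow v6.2, stub `stub_barlowFreeCertificate`, step (3):
for a bilayer motion `x ↦ T x + c` (`…TentBarlowFrames.lean`) and a finite atom set `X` of the moved stacking,
* `pullback T c X` — the cubic occupancy of the bilayer: sites `a` of the `(111)` layers `0, 1` with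
  `T (site a) + c ∈ X` (`mem_pullback`);
* `bondMap T c` — a cubic bond `(a, δ)` goes to the physical pair `(T (site a) + c, T (site (a+δ)) + c)`,
  injectively (`bondMap_injective`);
* the in-plane / inter-layer broken bonds of the pulled-back occupancy near `Φ⁻¹ U` (the bilayer currency
  `brokenNearIP / brokenNearIL` of `…TentBilayerTables.lean`) go to ordered broken bonds `(x, y)` of `X` in the
  stacking near `U` (`x ∈ X`, `y ∈ S ∖ X`, `dist x y = 1`, `infDist x U ≤ √2` — the set counted by the line's
  `brokenNearIn S X U`) whose two ends have EQUAL heights in `{i h, (i+1) h}` resp. the two DIFFERENT heights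
  `i h, (i+1) h` (`bondMap_brokenNearIP_subset`, `bondMap_brokenNearIL_subset`) — the hypotheses of the
  double count `sum_ncard_le_two_mul_ncard` of `…TentBarlowCount.lean`.
WHAT THIS IS NOT: the certificate; F-C1 not moved.
-/

noncomputable section

namespace Summit.Ventures.Crystal3D.TentCertificate

open Finset Summit.Ventures.Crystal3D MeasureTheory
open Literature.Geometry.DiscreteGeometry (intVec intVec_apply)
open scoped RealInnerProductSpace

/-! ## The motion as an isometry of `ℝ³` -/

/-- A rigid motion is an isometry. -/
theorem isometry_motion (T : E3 ≃ₗᵢ[ℝ] E3) (c : E3) : Isometry fun x : E3 => T x + c :=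
  Isometry.of_dist_eq fun _ _ => by rw [dist_add_right, T.dist_map]

/-- A rigid motion is surjective. -/
theorem surjective_motion (T : E3 ≃ₗᵢ[ℝ] E3) (c : E3) : Function.Surjective fun x : E3 => T x + c :=
  fun y => ⟨T.symm (y - c), by simp⟩

/-- A rigid motion is injective. -/
theorem injective_motion (T : E3 ≃ₗᵢ[ℝ] E3) (c : E3) : Function.Injective fun x : E3 => T x + c :=
  fun _ _ h => T.injective (add_right_cancel h)

/-- `infDist` is transported by a rigid motion. -/
theorem infDist_motion (T : E3 ≃ₗᵢ[ℝ] E3) (c : E3) (x : E3) (U : Set E3) :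
    Metric.infDist (T x + c) U = Metric.infDist x ((fun x : E3 => T x + c) ⁻¹' U) := by
  conv_lhs => rw [← Set.image_preimage_eq U (surjective_motion T c)]
  exact Metric.infDist_image (isometry_motion T c)

/-- The composite `a ↦ T (site a) + c` is injective. -/
theorem injective_motion_site (T : E3 ≃ₗᵢ[ℝ] E3) (c : E3) : Function.Injective fun a : Site => T (site a) + c :=
  fun _ _ h => site_injective (T.injective (add_right_cancel h))

/-! ## The pulled-back occupancy of one bilayer -/

/-- The cubic occupancy of a bilayer: sites of the layers `0, 1` whose moved position is an atom of `X`. -/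
def pullback (T : E3 ≃ₗᵢ[ℝ] E3) (c : E3) (X : Finset E3) : Finset Site :=
  (X.preimage (fun a : Site => T (site a) + c) (injective_motion_site T c).injOn).filter
    fun a => lay a = 0 ∨ lay a = 1

/-- Membership in the pulled-back occupancy. -/
theorem mem_pullback {T : E3 ≃ₗᵢ[ℝ] E3} {c : E3} {X : Finset E3} {a : Site} :
    a ∈ pullback T c X ↔ (lay a = 0 ∨ lay a = 1) ∧ T (site a) + c ∈ X := by
  rw [pullback, Finset.mem_filter, Finset.mem_preimage]; exact and_comm

/-! ## The bond map -/

/-- A cubic ordered bond `(a, δ)` goes to the physical ordered pair of its two ends. -/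
def bondMap (T : E3 ≃ₗᵢ[ℝ] E3) (c : E3) (q : Site × Site) : E3 × E3 :=
  (T (site q.1) + c, T (site (q.1 + q.2)) + c)

/-- The bond map is injective. -/
theorem bondMap_injective (T : E3 ≃ₗᵢ[ℝ] E3) (c : E3) : Function.Injective (bondMap T c) := by
  rintro ⟨a, δ⟩ ⟨a', δ'⟩ h
  simp only [bondMap, Prod.mk.injEq] at h
  obtain ⟨h1, h2⟩ := h
  have ha : a = a' := injective_motion_site T c h1
  have hs : a + δ = a' + δ' := injective_motion_site T c h2
  subst ha
  exact Prod.ext rfl (add_left_cancel hs)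

/-- The bond map preserves cardinalities. -/
theorem ncard_image_bondMap (T : E3 ≃ₗᵢ[ℝ] E3) (c : E3) (A : Set (Site × Site)) :
    (bondMap T c '' A).ncard = A.ncard :=
  Set.ncard_image_of_injective A (bondMap_injective T c)

/-- The two ends of a cubic bond are at distance `1` after the motion. -/
theorem dist_bondMap {T : E3 ≃ₗᵢ[ℝ] E3} {c : E3} {q : Site × Site} (hδ : q.2 ∈ fccOffsets) :
    dist (bondMap T c q).1 (bondMap T c q).2 = 1 := by
  simp only [bondMap, dist_add_right, T.dist_map]
  rw [dist_comm, dist_eq_norm, site_add, add_sub_cancel_left]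
  exact norm_site_of_mem_fccOffsets hδ

/-! ## Broken cubic bonds are broken bonds of the stacking -/

section OneBilayer

variable {L T : E3 ≃ₗᵢ[ℝ] E3} {s c : E3} {σ : ℤ → ℤ} {i : ℤ} {swap : Bool} {X : Finset E3} {U : Set E3}

/-- The ordered broken bonds of `X` in the stacking `S` near `U` (the set counted by `brokenNearIn S X U`). -/
def stackingBonds (S : Set E3) (X : Finset E3) (U : Set E3) : Set (E3 × E3) :=
  {p | p.1 ∈ X ∧ p.2 ∈ S ∧ p.2 ∉ X ∧ dist p.1 p.2 = 1 ∧ Metric.infDist p.1 U ≤ Real.sqrt 2}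

/-- Generic step: a broken cubic bond of the pulled-back occupancy with both ends in the layers `0, 1` goes to a
broken bond of `X` in the stacking near `U`. -/
theorem bondMap_mem_stackingBonds
    (hbil : ∀ a : Site, (lay a = 0 ∨ lay a = 1) → T (site a) + c ∈ Cruxes.TextureLiminf.TexShadow.bilayer L s σ i)
    {q : Site × Site} (h1 : q.1 ∈ pullback T c X) (hδ : q.2 ∈ fccOffsets) (h2 : q.1 + q.2 ∉ pullback T c X)
    (hl2 : lay (q.1 + q.2) = 0 ∨ lay (q.1 + q.2) = 1)
    (hd : Metric.infDist (site q.1) ((fun x : E3 => T x + c) ⁻¹' U) ≤ Real.sqrt 2) :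
    bondMap T c q ∈ stackingBonds (Cruxes.TextureLiminf.TexShadow.stacking L s σ) X U := by
  obtain ⟨hl1, hX1⟩ := mem_pullback.1 h1
  refine ⟨hX1, bilayer_subset_stacking L s σ i (hbil _ hl2), fun hX2 => h2 (mem_pullback.2 ⟨hl2, hX2⟩),
    dist_bondMap hδ, ?_⟩
  show Metric.infDist (T (site q.1) + c) U ≤ Real.sqrt 2
  rw [infDist_motion]; exact hd

/-- The height pattern of the motion: layer `l ∈ {0,1}` goes to height `(i + l) h` or `(i + 1 - l) h`. -/
def layerHeight (i : ℤ) (swap : Bool) (l : ℤ) : ℝ := ((i : ℝ) + (if swap then 1 - (l : ℝ) else (l : ℝ))) * hB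

/-- The two layer heights are `i h` and `(i+1) h` in some order. -/
theorem layerHeight_cases (i : ℤ) (swap : Bool) {l : ℤ} (hl : l = 0 ∨ l = 1) :
    layerHeight i swap l = i * hB ∨ layerHeight i swap l = (i + 1) * hB := by
  rcases hl with rfl | rfl <;> cases swap <;> simp [layerHeight]

/-- Different layers go to different heights, and together they are `{i h, (i+1) h}`. -/
theorem layerHeight_zero_one (i : ℤ) (swap : Bool) :
    (layerHeight i swap 0 = i * hB ∧ layerHeight i swap 1 = (i + 1) * hB) ∨
    (layerHeight i swap 0 = (i + 1) * hB ∧ layerHeight i swap 1 = i * hB) := by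
  cases swap <;> simp [layerHeight]

/-- **In-plane broken cubic bonds are same-height broken bonds of the stacking.** -/
theorem bondMap_brokenNearIP_subset
    (hbil : ∀ a : Site, (lay a = 0 ∨ lay a = 1) → T (site a) + c ∈ Cruxes.TextureLiminf.TexShadow.bilayer L s σ i)
    (hht : ∀ a : Site, (lay a = 0 ∨ lay a = 1) → height L s (T (site a) + c) = layerHeight i swap (lay a)) :
    bondMap T c '' brokenNearIP (pullback T c X) ((fun x : E3 => T x + c) ⁻¹' U) ⊆
      {p | p ∈ stackingBonds (Cruxes.TextureLiminf.TexShadow.stacking L s σ) X U ∧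
        height L s p.1 = height L s p.2 ∧ (height L s p.1 = i * hB ∨ height L s p.1 = (i + 1) * hB)} := by
  rintro _ ⟨q, ⟨h1, hδ, h2, hd, hlay, hl1⟩, rfl⟩
  have hl2 : lay (q.1 + q.2) = 0 ∨ lay (q.1 + q.2) = 1 := by rw [hlay]; exact hl1
  refine ⟨bondMap_mem_stackingBonds hbil h1 hδ h2 hl2 hd, ?_, ?_⟩
  · show height L s (T (site q.1) + c) = height L s (T (site (q.1 + q.2)) + c)
    rw [hht _ hl1, hht _ hl2, hlay]
  · show height L s (T (site q.1) + c) = i * hB ∨ height L s (T (site q.1) + c) = (i + 1) * hB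
    rw [hht _ hl1]; exact layerHeight_cases i swap hl1

/-- **Inter-layer broken cubic bonds are broken bonds of the stacking between the heights `i h, (i+1) h`.** -/
theorem bondMap_brokenNearIL_subset
    (hbil : ∀ a : Site, (lay a = 0 ∨ lay a = 1) → T (site a) + c ∈ Cruxes.TextureLiminf.TexShadow.bilayer L s σ i)
    (hht : ∀ a : Site, (lay a = 0 ∨ lay a = 1) → height L s (T (site a) + c) = layerHeight i swap (lay a)) :
    bondMap T c '' brokenNearIL (pullback T c X) ((fun x : E3 => T x + c) ⁻¹' U) ⊆
      {p | p ∈ stackingBonds (Cruxes.TextureLiminf.TexShadow.stacking L s σ) X U ∧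
        ((height L s p.1 = i * hB ∧ height L s p.2 = (i + 1) * hB) ∨
          (height L s p.1 = (i + 1) * hB ∧ height L s p.2 = i * hB))} := by
  rintro _ ⟨q, ⟨h1, hδ, h2, hd, hlay⟩, rfl⟩
  have hl1 : lay q.1 = 0 ∨ lay q.1 = 1 := by rcases hlay with ⟨h, -⟩ | ⟨h, -⟩ <;> simp [h]
  have hl2 : lay (q.1 + q.2) = 0 ∨ lay (q.1 + q.2) = 1 := by rcases hlay with ⟨-, h⟩ | ⟨-, h⟩ <;> simp [h]
  refine ⟨bondMap_mem_stackingBonds hbil h1 hδ h2 hl2 hd, ?_⟩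
  show (height L s (T (site q.1) + c) = i * hB ∧ height L s (T (site (q.1 + q.2)) + c) = (i + 1) * hB) ∨
    (height L s (T (site q.1) + c) = (i + 1) * hB ∧ height L s (T (site (q.1 + q.2)) + c) = i * hB)
  rw [hht _ hl1, hht _ hl2]
  rcases layerHeight_zero_one i swap with ⟨e0, e1⟩ | ⟨e0, e1⟩ <;> rcases hlay with ⟨a0, b1⟩ | ⟨a1, b0⟩
  · left; rw [a0, b1]; exact ⟨e0, e1⟩
  · right; rw [a1, b0]; exact ⟨e1, e0⟩
  · right; rw [a0, b1]; exact ⟨e0, e1⟩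
  · left; rw [a1, b0]; exact ⟨e1, e0⟩

/-- **An occupied bilayer is indexed by the heights of `X`**: if the pulled-back occupancy of bilayer `i` is
nonempty, `i` is `⌊height x / h⌋` or `⌊height x / h⌋ - 1` for some atom `x ∈ X`. -/
theorem exists_floor_of_pullback_nonempty
    (hht : ∀ a : Site, (lay a = 0 ∨ lay a = 1) → height L s (T (site a) + c) = layerHeight i swap (lay a))
    {a : Site} (ha : a ∈ pullback T c X) :
    ∃ x ∈ X, i = ⌊height L s x / hB⌋ ∨ i = ⌊height L s x / hB⌋ - 1 := by
  obtain ⟨hl, hx⟩ := mem_pullback.1 ha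
  refine ⟨_, hx, ?_⟩
  have hh := hB_pos
  rw [hht a hl]
  rcases layerHeight_cases i swap hl with h | h <;> rw [h]
  · left; rw [mul_div_cancel_right₀ _ hh.ne', Int.floor_intCast]
  · right
    rw [mul_div_cancel_right₀ _ hh.ne', show ((i : ℝ) + 1) = ((i + 1 : ℤ) : ℝ) by push_cast; ring,
      Int.floor_intCast]; ring

/-- If the pulled-back occupancy is empty, there are no broken cubic bonds. -/
theorem brokenNearIP_eq_empty_of_pullback (h : pullback T c X = ∅) (V : Set E3) :
    brokenNearIP (pullback T c X) V = ∅ := by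
  ext q; simp only [brokenNearIP, h, Finset.notMem_empty, false_and, Set.mem_setOf_eq, Set.mem_empty_iff_false]

/-- If the pulled-back occupancy is empty, there are no broken cubic bonds (inter-layer). -/
theorem brokenNearIL_eq_empty_of_pullback (h : pullback T c X = ∅) (V : Set E3) :
    brokenNearIL (pullback T c X) V = ∅ := by
  ext q; simp only [brokenNearIL, h, Finset.notMem_empty, false_and, Set.mem_setOf_eq, Set.mem_empty_iff_false]

end OneBilayer

/-! ## The set of broken bonds of the stacking is finite -/

/-- The broken bonds of a finite atom set of a moved Barlow stacking near any set form a finite set. -/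
theorem stackingBonds_finite {L : E3 ≃ₗᵢ[ℝ] E3} {s : E3} {σ : ℤ → ℤ}
    (hσ : Literature.MathematicalPhysics.StatisticalMechanics.IsHaggSeq σ) (X : Finset E3)
    (hX : (↑X : Set E3) ⊆ Cruxes.TextureLiminf.TexShadow.stacking L s σ) (U : Set E3) :
    (stackingBonds (Cruxes.TextureLiminf.TexShadow.stacking L s σ) X U).Finite := by
  have hfin : (⋃ x ∈ (↑X : Set E3), ({x} : Set E3) ×ˢ
      {y | y ∈ Cruxes.TextureLiminf.TexShadow.stacking L s σ ∧ dist x y = 1}).Finite :=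
    Set.Finite.biUnion X.finite_toSet fun x hx => (Set.finite_singleton x).prod (finite_touching hσ (hX hx))
  refine hfin.subset ?_
  rintro ⟨x, y⟩ ⟨hx, hy, -, hd, -⟩
  exact Set.mem_biUnion hx ⟨rfl, hy, hd⟩

/-- `brokenNearIn` is the cardinality of `stackingBonds`. -/
theorem brokenNearIn_eq (S : Set E3) (X : Finset E3) (U : Set E3) :
    Cruxes.TextureLiminf.TexShadow.brokenNearIn S X U = (stackingBonds S X U).ncard := rfl

end Summit.Ventures.Crystal3D.TentCertificate

end
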